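import Literature.Analysis.FunctionSpaces.HolderManifoldNemytskii
import Literature.Analysis.FunctionSpaces.HolderManifoldRegularity
import Literature.Geometry.Riemannian.GurskyViaclovskyChartStructure
import Literature.Geometry.Riemannian.GurskyViaclovskyLinearisation
import Literature.Geometry.Riemannian.GurskyViaclovskyClosednessBootstrapAux
import Literature.Geometry.Riemannian.GurskyViaclovskyClosednessExtraction
import Literature.Geometry.Riemannian.GurskyViaclovskyChartEquationC2
import HarnessLib

/-!
# Route EntropyRung · crux `ChangGurskyYang` · line `margerin-cone-hamilton-rails` — STUB O1
# (`stub_pathMapStrictFDeriv`: the Gursky–Viaclovsky zero-finding map is a strictly differentiable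
# map of Hölder–Banach spaces, with the tree's linearisation as its partial derivative)

STUB O1 of the skeleton `Cruxes/ChangGurskyYang/Lines/margerin_cone_hamilton_rails.lean` (r17) of
crux stmt-SmoothPoincare4-10834 (`Summit.SmoothPoincare4.SmoothPoincare4.Theses.EntropyRung.ChangGurskyYang`):
the first hypothesis of the implicit function theorem in Gursky–Viaclovsky's openness step (2003,
Prop. 2 and §5; Gilbarg–Trudinger Thm. 17.6). For Hölder chart data `𝔄` on the compact `M`, a
smooth Riemannian `g`, a smooth `q` and `0 ≤ α ≤ 1` there is a map

  `Φ : ℝ × C^{2,α}_𝔄(M) → C^{0,α}_𝔄(M)`,  `Φ(t, w)(x) = F_t(w)(x) − q(x) e^{−4 w(x)}`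

(`F_t = backgroundPathOperator g t`, the weighted `σ₂` path operator read on the background,
`GurskyViaclovskyOpennessProofs.lean`), strictly differentiable everywhere, whose partial derivative
in `w` is POINTWISE the tree's linearisation `𝓛_{t,w}φ + 4q e^{−4w}φ`
(`GurskyViaclovskyLinearisation.linearisedBackgroundOperator`).

Proof (this file only assembles landed Literature pieces):
* in the chart at `c`, `F_t(w)(chart⁻¹ y) = chartOperator G_c t (|W|²∘chart⁻¹)(y) y (−Dŵ) (−D²ŵ)`
  for every `C²` function `w`, `ŵ = w ∘ chart⁻¹` (`backgroundPathOperator_chart_eq_chartOperator_of_contMDiff_two`,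
  the `C²` version of the closedness programme's chart equation, `GurskyViaclovskyChartEquationC2.lean`; components `G_c` of the pulled-back metric, smooth,
  symmetric, nondegenerate on the chart target — `chart_structure_data`);
* the chart operator is a GLOBALLY smooth function `𝒩` of the frozen coefficients
  `(|W|², q, G_y, ♯_y, Γ_y, Ric_y)` and of the `2`-jet (`exists_contDiff_chartStructure`,
  `GurskyViaclovskyChartStructure.lean`), the coefficients being smooth on the chart target and cut
  off near the chart piece (`𝔄.cutoff`);
* hence (`exists_contDiff_manifoldNemytskii`, `HolderManifoldNemytskii.lean`: chart restriction,
  smooth superposition operators on chart Hölder spaces, chart extension, `Σⱼ ρⱼ = 1`) a `C^∞` map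
  `Φ` with `Φ(t, w)(x) = Σⱼ ρⱼ(x)·(F_t(w)(x) − q(x)e^{−4w(x)}) = F_t(w)(x) − q(x)e^{−4w(x)}`;
* `C^∞ ⇒` strictly differentiable; evaluating at `x` (continuous, linear) along the line
  `s ↦ (t, w + sφ)` and comparing with the pointwise derivative
  `hasDerivAt_backgroundPathOperator` identifies `∂_wΦ(t,w)φ (x)` by uniqueness of derivatives.

## References

* M. J. Gursky, J. A. Viaclovsky, J. Differential Geom. 63 (2003) 131–154, §2 (proof of Prop. 2)
  and §5. [GurskyViaclovsky2003]
* D. Gilbarg, N. S. Trudinger, *Elliptic Partial Differential Equations of Second Order* (2001),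
  Thm. 17.6. [GilbargTrudinger2001]
-/

noncomputable section

set_option linter.dupNamespace false
-- spaces of iterated continuous linear maps need a deeper instance search
set_option maxSynthPendingDepth 3

open Set Function Filter
open scoped Manifold ContDiff Topology NNReal

namespace Summit.SmoothPoincare4.SmoothPoincare4.Theorems.MargerinRails

open Literature.Analysis.FunctionSpaces Literature.Geometry.Riemannian
open Literature.Geometry.Riemannian.GurskyViaclovskyPath
open Literature.Geometry.Lorentzian Literature.Geometry.Lorentzian.PseudoRiemannianMetric
open Literature.Geometry.Lorentzian.MetricCoord

/-! ### The chart data at a centre `c` -/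

section ChartData

variable {M : Type} [TopologicalSpace M] [ChartedSpace (EuclideanSpace ℝ (Fin 4)) M]
  [IsManifold (𝓡 4) ∞ M]
  (g : PseudoRiemannianMetric (𝓡 4) ∞ (EuclideanSpace ℝ (Fin 4)) (TangentSpace (𝓡 4) : M → Type _))
  [g.HasLeviCivita]

/-- **The chart structure data at a centre `c`.** Components `G` of the pulled-back metric on the
chart target (smooth, symmetric, nondegenerate: `IsMetricOn`), the Weyl weight `W = |W_g|² ∘ chart⁻¹`
and the right side `Q = q ∘ chart⁻¹` (both smooth on the target), and the chart form of the
background path operator for every `C²` function `w`: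
`F_t(w)(chart⁻¹ y) = chartOperator G t (W y) y (−Dŵ(y)) (−D²ŵ(y))`, `ŵ = w ∘ chart⁻¹`.
[cite: GurskyViaclovsky2003, §1 (change1)–(PDE)] -/
theorem chart_structure_data (hg : g.IsRiemannian) {q : M → ℝ}
    (hq : ContMDiff (𝓡 4) 𝓘(ℝ) ∞ q) (c : M) :
    ∃ (G : EuclideanSpace ℝ (Fin 4) →
        EuclideanSpace ℝ (Fin 4) →L[ℝ] EuclideanSpace ℝ (Fin 4) →L[ℝ] ℝ)
      (W Q : EuclideanSpace ℝ (Fin 4) → ℝ),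
      IsMetricOn G (chartAt (EuclideanSpace ℝ (Fin 4)) c).target ∧
      ContDiffOn ℝ ∞ W (chartAt (EuclideanSpace ℝ (Fin 4)) c).target ∧
      ContDiffOn ℝ ∞ Q (chartAt (EuclideanSpace ℝ (Fin 4)) c).target ∧
      (∀ y, Q y = q ((chartAt (EuclideanSpace ℝ (Fin 4)) c).symm y)) ∧
      ∀ (t : ℝ) (w : M → ℝ), ContMDiff (𝓡 4) 𝓘(ℝ) 2 w →
        ∀ y ∈ (chartAt (EuclideanSpace ℝ (Fin 4)) c).target,
          backgroundPathOperator g t w ((chartAt (EuclideanSpace ℝ (Fin 4)) c).symm y) =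
            chartOperator G t (W y) y
              (-fderiv ℝ (fun z => w ((chartAt (EuclideanSpace ℝ (Fin 4)) c).symm z)) y)
              (-fderiv ℝ (fderiv ℝ (fun z => w ((chartAt (EuclideanSpace ℝ (Fin 4)) c).symm z))) y) := by
  classical
  -- the inverse chart at `c` and the pulled-back metric (as in the closedness programme)
  set U : TopologicalSpace.Opens (EuclideanSpace ℝ (Fin 4)) :=
    ⟨(chartAt (EuclideanSpace ℝ (Fin 4)) c).target,
      (chartAt (EuclideanSpace ℝ (Fin 4)) c).open_target⟩
  set Φ : U → M := fun u ↦ (chartAt (EuclideanSpace ℝ (Fin 4)) c).symm u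
  have hΦ : ContMDiff 𝓘(ℝ, EuclideanSpace ℝ (Fin 4)) 𝓘(ℝ, EuclideanSpace ℝ (Fin 4)) (∞ + 1) Φ :=
    ChartInverseSelf.contMDiff_symm c
  have hΦ' : ∀ u, Function.Injective
      (mfderiv 𝓘(ℝ, EuclideanSpace ℝ (Fin 4)) 𝓘(ℝ, EuclideanSpace ℝ (Fin 4)) Φ u) :=
    ChartInverseSelf.injective_mfderiv_symm c
  have hdim : Module.finrank ℝ (EuclideanSpace ℝ (Fin 4)) =
      Module.finrank ℝ (EuclideanSpace ℝ (Fin 4)) := rfl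
  have hpb : contMDiff_pullbackBilin 𝓘(ℝ, EuclideanSpace ℝ (Fin 4)) M
      𝓘(ℝ, EuclideanSpace ℝ (Fin 4)) U ∞ := contMDiff_pullbackBilin_holds
  set gU := g.comap hpb Φ hΦ hΦ' hdim
  haveI : gU.HasLeviCivita := gU.hasLeviCivita
  set G : EuclideanSpace ℝ (Fin 4) →
      EuclideanSpace ℝ (Fin 4) →L[ℝ] EuclideanSpace ℝ (Fin 4) →L[ℝ] ℝ :=
    Function.extend (Subtype.val : U → EuclideanSpace ℝ (Fin 4))
      (fun y : U ↦ (gU.val y :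
        EuclideanSpace ℝ (Fin 4) →L[ℝ] EuclideanSpace ℝ (Fin 4) →L[ℝ] ℝ)) (fun _ ↦ 0) with hGdef
  have hG : ∀ y : U, gU.val y = G y := fun y ↦ by
    rw [hGdef, Subtype.val_injective.extend_apply]
  have hmet : IsMetricOn G (U : Set (EuclideanSpace ℝ (Fin 4))) := OpensChart.isMetricOn_repr hG
  have hgUR : gU.IsRiemannian := fun z v hv ↦ by
    have h1 : gU.val z v v = g.val (Φ z)
        (mfderiv 𝓘(ℝ, EuclideanSpace ℝ (Fin 4)) 𝓘(ℝ, EuclideanSpace ℝ (Fin 4)) Φ z v)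
        (mfderiv 𝓘(ℝ, EuclideanSpace ℝ (Fin 4)) 𝓘(ℝ, EuclideanSpace ℝ (Fin 4)) Φ z v) := rfl
    rw [h1]
    exact hg _ _ fun h0 ↦ hv ((hΦ' z) (by
      rw [h0]
      exact ((mfderiv 𝓘(ℝ, EuclideanSpace ℝ (Fin 4)) 𝓘(ℝ, EuclideanSpace ℝ (Fin 4)) Φ
        z).map_zero).symm))
  -- the Weyl weight and the right-hand side in the chart
  set W : EuclideanSpace ℝ (Fin 4) → ℝ :=
    fun z ↦ g.weylNormSq ((chartAt (EuclideanSpace ℝ (Fin 4)) c).symm z)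
  have hWy : ∀ y : U, W y = gU.weylNormSq y := fun y ↦
    (g.weylNormSq_comap hpb hΦ hΦ' hdim hg y).symm
  have hW : ContDiffOn ℝ ∞ W (U : Set (EuclideanSpace ℝ (Fin 4))) :=
    contDiffOn_of_eq_weylNormSq gU hG hgUR hWy
  set Q : EuclideanSpace ℝ (Fin 4) → ℝ :=
    fun z ↦ q ((chartAt (EuclideanSpace ℝ (Fin 4)) c).symm z)
  have hQ : ContDiffOn ℝ ∞ Q (U : Set (EuclideanSpace ℝ (Fin 4))) :=
    contDiffOn_comp_chart_symm hq c Subset.rfl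
  refine ⟨G, W, Q, hmet, hW, hQ, fun y => rfl, fun t w hw y hy => ?_⟩
  -- the chart equation for `C²` functions, in the `u = −w` convention of the tree
  have h := backgroundPathOperator_chart_eq_chartOperator_of_contMDiff_two g hg t (u := fun m => -w m)
    hw.neg c hy
  simp only [neg_neg] at h
  have e1 : fderiv ℝ (fun z => -w ((chartAt (EuclideanSpace ℝ (Fin 4)) c).symm z)) y =
      -fderiv ℝ (fun z => w ((chartAt (EuclideanSpace ℝ (Fin 4)) c).symm z)) y := fderiv_neg
  have e2 : fderiv ℝ (fderiv ℝ fun z => -w ((chartAt (EuclideanSpace ℝ (Fin 4)) c).symm z)) y =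
      -fderiv ℝ (fderiv ℝ fun z => w ((chartAt (EuclideanSpace ℝ (Fin 4)) c).symm z)) y := by
    have e : fderiv ℝ (fun z => -w ((chartAt (EuclideanSpace ℝ (Fin 4)) c).symm z)) =
        fun z => -fderiv ℝ (fun z' => w ((chartAt (EuclideanSpace ℝ (Fin 4)) c).symm z')) z := by
      funext z; exact fderiv_neg
    rw [e]
    exact fderiv_neg
  rw [e1, e2] at h
  exact h

end ChartData

/-! ### The stub -/

/-- Evaluation at a point is a continuous linear functional on `C^{k,r}_𝔄(M)`. [folklore] -/
theorem hasFDerivAt_eval {ι : Type} [Fintype ι] {E : Type} [NormedAddCommGroup E] [NormedSpace ℝ E]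
    {N : Type*} [TopologicalSpace N] [ChartedSpace E N] (𝔄 : HolderChartData ι E N) {k : ℕ}
    {r : ℝ≥0} (x : N) :
    ∃ ev : HolderManifoldFunction 𝔄 ℝ k r →L[ℝ] ℝ, ∀ u, ev u = u x :=
  ⟨{ toFun := fun u => u x,
      map_add' := fun _ _ => rfl,
      map_smul' := fun _ _ => rfl,
      cont := HolderManifoldFunction.continuous_eval x }, fun _ => rfl⟩

/-- **STUB O1 — THE ZERO-FINDING MAP `Φ(t, w) = F_t(w) − q e^{−4w}` IS STRICTLY DIFFERENTIABLE
`ℝ × C^{2,α}_𝔄 → C^{0,α}_𝔄` WITH `∂_w Φ = 𝓛_{t,w} + 4q e^{−4w}`** (registered signature of the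
skeleton r17; see the module docstring for the proof). [cite: GurskyViaclovsky2003, §2 proof of Prop. 2 and §5]
[cite: GilbargTrudinger2001, Thm. 17.6] -/
theorem stub_pathMapStrictFDeriv :
    ∀ (M : Type) [TopologicalSpace M] [T2Space M] [ChartedSpace (EuclideanSpace ℝ (Fin 4)) M]
      [IsManifold (𝓡 4) ∞ M] [CompactSpace M] {ι : Type} [Fintype ι]
      (𝔄 : HolderChartData ι (EuclideanSpace ℝ (Fin 4)) M)
      (g : PseudoRiemannianMetric (𝓡 4) ∞ (EuclideanSpace ℝ (Fin 4)) (TangentSpace (𝓡 4) : M → Type _))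
      [g.HasLeviCivita], g.IsRiemannian →
      ∀ (q : M → ℝ), ContMDiff (𝓡 4) 𝓘(ℝ) ∞ q → ∀ {α : ℝ≥0} (_hα : α ≤ 1),
      ∃ Φ : ℝ × HolderManifoldFunction 𝔄 ℝ 2 α → HolderManifoldFunction 𝔄 ℝ 0 α,
        (∀ (t : ℝ) (w : HolderManifoldFunction 𝔄 ℝ 2 α) (x : M),
          Φ (t, w) x = backgroundPathOperator g t w x - q x * Real.exp (-4 * w x)) ∧
        ∀ (t : ℝ) (w : HolderManifoldFunction 𝔄 ℝ 2 α),
          ∃ Φ' : ℝ × HolderManifoldFunction 𝔄 ℝ 2 α →L[ℝ] HolderManifoldFunction 𝔄 ℝ 0 α,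
            HasStrictFDerivAt Φ Φ' (t, w) ∧
            ∀ (φ : HolderManifoldFunction 𝔄 ℝ 2 α) (x : M),
              Φ' ((0 : ℝ), φ) x =
                linearisedBackgroundOperator g t w φ x + 4 * q x * Real.exp (-4 * w x) * φ x := by
  intro M _ _ _ _ _ ι _ 𝔄 g _ hg q hq α hα
  classical
  -- the structure function and the chart data
  obtain ⟨𝒩, h𝒩, h𝒩_eq⟩ := exists_contDiff_chartStructure (E := EuclideanSpace ℝ (Fin 4))
  choose G W Q hmet hW hQ hQ_eq hchart using fun j : ι => chart_structure_data g hg hq (𝔄.center j)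
  -- the cut-off frozen coefficients `Cⱼ = ηⱼ • (W, Q, G, ♯, Γ, Ric)` as members of `C^{0,α}_b`
  have hCfun : ∀ j, ContDiffOn ℝ ∞ (fun y => (W j y, Q j y, G j y, sharpAt (G j) y, chrAt (G j) y,
      ricAt (G j) y)) (𝔄.chart j).target := fun j =>
    (hW j).prodMk ((hQ j).prodMk ((hmet j).contDiffOn.prodMk ((hmet j).contDiffOn_sharpAt.prodMk
      ((hmet j).contDiffOn_chrAt.prodMk (hmet j).contDiffOn_ricAt))))
  have hC : ∀ j, ContDiff ℝ ∞ fun y => 𝔄.cutoff j y • (W j y, Q j y, G j y, sharpAt (G j) y,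
      chrAt (G j) y, ricAt (G j) y) := fun j =>
    (𝔄.contDiff_cutoff j).smul_of_contDiffOn (𝔄.chart j).open_target (hCfun j)
      (𝔄.tsupport_cutoff_subset j)
  have hCc : ∀ j, HasCompactSupport fun y => 𝔄.cutoff j y • (W j y, Q j y, G j y, sharpAt (G j) y,
      chrAt (G j) y, ricAt (G j) y) := fun j => (𝔄.hasCompactSupport_cutoff j).smul_right
  let C : ι → ContDiffHolderFunction (EuclideanSpace ℝ (Fin 4)) (ℝ × (ℝ × ((EuclideanSpace ℝ (Fin 4) →L[ℝ]
      EuclideanSpace ℝ (Fin 4) →L[ℝ] ℝ) × (((EuclideanSpace ℝ (Fin 4) →L[ℝ] ℝ) →L[ℝ]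
      EuclideanSpace ℝ (Fin 4)) × ((EuclideanSpace ℝ (Fin 4) →L[ℝ] EuclideanSpace ℝ (Fin 4) →L[ℝ]
      EuclideanSpace ℝ (Fin 4)) × (EuclideanSpace ℝ (Fin 4) →L[ℝ] EuclideanSpace ℝ (Fin 4) →L[ℝ] ℝ))))))
      0 α := fun j => ⟨_, MemContDiffHolder.of_contDiff_of_hasCompactSupport (hC j) (hCc j) hα⟩
  have hC_apply : ∀ j y, C j y = 𝔄.cutoff j y • (W j y, Q j y, G j y, sharpAt (G j) y, chrAt (G j) y,
      ricAt (G j) y) := fun j y => rfl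
  -- the smooth map through the charts
  obtain ⟨Φ, hΦ, hΦ_eq⟩ :=
    exists_contDiff_manifoldNemytskii 𝔄 hα (fun _ => 𝒩) (fun _ => h𝒩) C
  -- its pointwise value
  have hval : ∀ (t : ℝ) (w : HolderManifoldFunction 𝔄 ℝ 2 α) (x : M),
      Φ (t, w) x = backgroundPathOperator g t w x - q x * Real.exp (-4 * w x) := by
    intro t w x
    have hw2 : ContMDiff (𝓡 4) 𝓘(ℝ) 2 (w : M → ℝ) := w.contMDiff
    rw [hΦ_eq]
    have key : ∀ j, 𝔄.ρ j x * 𝒩 (t, C j (𝔄.chart j x), w x,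
        fderiv ℝ (fun y => w ((𝔄.chart j).symm y)) (𝔄.chart j x),
        fderiv ℝ (fderiv ℝ (fun y => w ((𝔄.chart j).symm y))) (𝔄.chart j x)) =
        𝔄.ρ j x * (backgroundPathOperator g t w x - q x * Real.exp (-4 * w x)) := by
      intro j
      by_cases hx : 𝔄.ρ j x = 0
      · rw [hx, zero_mul, zero_mul]
      · have hxs : x ∈ (𝔄.chart j).source := by
          by_contra h
          exact hx (𝔄.ρ_eq_zero h)
        have hy : 𝔄.chart j x ∈ (𝔄.chart j).target := (𝔄.chart j).map_source hxs
        have hη : 𝔄.cutoff j (𝔄.chart j x) = 1 := (𝔄.cutoff_eventuallyEq_one hx).self_of_nhds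
        rw [hC_apply, hη, one_smul, h𝒩_eq, ← hchart j t w hw2 _ hy, hQ_eq,
          (𝔄.chart j).left_inv hxs]
    rw [Finset.sum_congr rfl fun j _ => key j]
    have hsum := 𝔄.sum_smul_eq x (backgroundPathOperator g t w x - q x * Real.exp (-4 * w x))
    simpa only [smul_eq_mul] using hsum
  refine ⟨Φ, hval, fun t w => ?_⟩
  -- strict differentiability from smoothness
  have hsd : HasStrictFDerivAt Φ (fderiv ℝ Φ (t, w)) (t, w) :=
    hΦ.contDiffAt.hasStrictFDerivAt (by simp)
  refine ⟨fderiv ℝ Φ (t, w), hsd, fun φ x => ?_⟩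
  -- evaluate at `x` along the line `s ↦ (t, w + s • φ)`
  obtain ⟨ev, hev⟩ := hasFDerivAt_eval 𝔄 (k := 0) (r := α) x
  have hline : HasDerivAt (fun s : ℝ => ((t, w + s • φ) : ℝ × HolderManifoldFunction 𝔄 ℝ 2 α))
      (((0 : ℝ), φ) : ℝ × HolderManifoldFunction 𝔄 ℝ 2 α) 0 := by
    have h1 : HasDerivAt (fun s : ℝ => w + s • φ) φ 0 := by
      simpa using ((hasDerivAt_id (0 : ℝ)).smul_const φ).const_add w
    exact (hasDerivAt_const (0 : ℝ) t).prodMk h1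
  have hcomp : HasDerivAt (fun s : ℝ => ev (Φ (t, w + s • φ))) (ev (fderiv ℝ Φ (t, w) ((0 : ℝ), φ))) 0 := by
    have h0 : ((t, w + (0 : ℝ) • φ) : ℝ × HolderManifoldFunction 𝔄 ℝ 2 α) = (t, w) := by simp
    have hF : HasFDerivAt (fun p => ev (Φ p)) (ev ∘L fderiv ℝ Φ (t, w))
        ((t, w + (0 : ℝ) • φ) : ℝ × HolderManifoldFunction 𝔄 ℝ 2 α) := by
      rw [h0]
      exact ev.hasFDerivAt.comp _ hsd.hasFDerivAt
    have h := hF.comp_hasDerivAt (0 : ℝ) hline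
    simpa only [Function.comp_def, ContinuousLinearMap.comp_apply] using h
  -- the same function computed pointwise
  have hfun : (fun s : ℝ => ev (Φ (t, w + s • φ))) = fun s =>
      backgroundPathOperator g t (fun y => w y + s * φ y) x -
        q x * Real.exp (-4 * (w x + s * φ x)) := by
    funext s
    have hcoe : ((w + s • φ : HolderManifoldFunction 𝔄 ℝ 2 α) : M → ℝ) = fun y => w y + s * φ y := by
      funext y
      simp only [HolderManifoldFunction.coe_add, HolderManifoldFunction.coe_smul, Pi.add_apply,
        Pi.smul_apply, smul_eq_mul]
    rw [hev, hval, hcoe]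
  have hpt : HasDerivAt (fun s : ℝ => backgroundPathOperator g t (fun y => w y + s * φ y) x -
      q x * Real.exp (-4 * (w x + s * φ x)))
      (linearisedBackgroundOperator g t w φ x - q x * (Real.exp (-4 * (w x + 0 * φ x)) * (-4 * φ x)))
      0 := by
    refine (hasDerivAt_backgroundPathOperator g (w.contMDiff x) (φ.contMDiff x) t).sub ?_
    have h1 : HasDerivAt (fun s : ℝ => -4 * (w x + s * φ x)) (-4 * φ x) 0 := by
      simpa using (((hasDerivAt_id (0 : ℝ)).mul_const (φ x)).const_add (w x)).const_mul (-4 : ℝ)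
    exact (h1.exp).const_mul (q x)
  rw [hfun] at hcomp
  have huniq := hcomp.unique hpt
  rw [hev] at huniq
  rw [huniq]
  simp only [zero_mul, add_zero]
  ring

end Summit.SmoothPoincare4.SmoothPoincare4.Theorems.MargerinRails

end
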